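import Mathlib
import Summits.Ventures.FusionMHD.Bench.SAlphaS2W121875A121875Panels
import Summits.Ventures.FusionMHD.Bench.SAlphaS2W121875A125Panels
import Literature.MathematicalPhysics.MHD.BallooningSAlphaWitnessInterval
import Summits.Ventures.FusionMHD.Models.SAlphaStableS2A115625
import HarnessLib

/-!
# F3 — SECOND-ROUND HALF-GAP END MOVE AT SHEAR `s = 2` (UPPER END): `39/32 ∈ U_{2}` — with gridfusion-lit-4's
# `SAlphaStableS2A115625.stableSide : SAlpha.StableSide (2) (37/32)` the first-stability edge of the `s–α` MODEL at `s = 2` lies in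
# `[37/32, 39/32]` (width `1/16` = HALF of ★ #270's `[9/8, 5/4]`); and `U_{2} ⊇ [39/32, 5/4]` by ONE trial function (joins the record at `5/4`)
(venture LADDER-GRIDFUSION, rung F3; cell `gridfusion`; gridfusion-model-7 (g10), 2026-08-28, in gridfusion-lit-3's finite-element lane.
DIRECTOR RULING 67 (3) / lead RULING 9gl: a COUNTED half-gap END MOVE is a tree theorem putting the edge inside a sub-interval of at most half
the width of the bracket of record; at `s = 2` the bracket of record is ★ #270's `[9/8, 5/4]` (width `1/8`); this file
and lit-4's `p628952` give `[37/32, 39/32]` (width `1/16`).)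

WHAT IS PROVED (kernel, std axioms; the 2 × 16 interval integrals are `decide +kernel` facts of the two Panels files):
* `unstableWitness_121875 : UnstableWitness (2) (39/32) (−16) 16 X X′` and `unstableWitness_125 : UnstableWitness (2) (5/4) (−16) 16 X X′` for the
  SAME explicit `C²` piecewise-quintic `X = trialX 1 1 pieces (−16)` (`2⁶⁰·W ≤` the printed negative integers);
* `unstableWitness_band : ∀ α ∈ Icc (39/32) (5/4), UnstableWitness (2) α (−16) 16 X X′` (lit-3's `unstableWitness_of_mem_Icc`: the energy of
  a fixed trial function is a convex quadratic in `α`), `not_stableSide_of_mem_band`;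
* ★★★ `endMove_two : StableSide (2) (37/32) ∧ ¬ StableSide (2) (39/32)` — the JOINT ROW in one statement (lower cell = lit-4's
  `Summit.Ventures.FusionMHD.Models.SAlphaStableS2A115625.stableSide`, p628952, BY NAME).

## THREE COLUMNS
CERTIFIED: in the `s–α` ballooning MODEL at shear `s = 2`, with `U_{2}` = the set of `α` at which some compact window carries an
instability witness (lit-3's `SAlpha.UnstableWitness`): `37/32 ∉ U` (lit-4, Picone/Riccati core + tail) and `[39/32, 5/4] ⊆ U` (this file) ⇒
`inf {α ≥ 37/32 : α ∈ U} ∈ [37/32, 39/32]` CLOSED, width `1/16`; with model-7's `SAlphaPolyWitnessS2A125*` (`5/4`, ★ #231)` and ★ #250's lens the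
certified unstable set at `s = 2` stays ONE connected interval from `39/32` up to `lensHi (2)`.  Monotonicity / continuity of the edge in `α`
NOT typed.  VALIDATED (not in the kernel): E–L shooting edge `α ≈ 1.18` (lit-4 kit j299948); float energies above; the printed fit
`α ≈ 0.6 s` (12.100) gives `1.2`.  MODELLED: `s–α` model (large-aspect-ratio shifted circles, high-`n` ballooning ordering, `θ₀ = 0`, ideal MHD);
«unstable» = the MODEL's one-surface energy admits a negative compactly supported `C¹` trial function (representation step `W̄ < 0 ⇒ δW < 0`,
Connor–Hastie–Taylor 1979, quoted in the Literature file, NOT typed); no device, no `β`-limit, no second-stability claim here.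
Citations: Freidberg 2014 §8.7 (p0318), §12.3 (12.38)–(12.40), §12.6.2 (12.96)–(12.100) [Freidberg2014]; Mahboubi–Melquiond–Sibut-Pinote 2016
§3.2–3.3 [MahboubiMelquiondSibutpinote2016].
-/

open Literature.Analysis.ValidatedNumerics Literature.Analysis.ValidatedNumerics.PolyMP
open Literature.Analysis.ValidatedNumerics.NumericsMP Literature.Analysis.ValidatedNumerics.ExpPoly
open Literature.MathematicalPhysics.MHD.Ballooning Literature.MathematicalPhysics.MHD.Ballooning.SAlpha
open Literature.MathematicalPhysics.MHD.Ballooning.SAlpha.Spline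
open Set

namespace Summit.Ventures.FusionMHD.Bench.SAlphaS2W121875

/-- THE GLUED SEGMENT at `α = 39/32` in summed form. [cite: MahboubiMelquiondSibutpinote2016, Sect. 3.3] -/
theorem c121875_seg_all :
    FSegOK (splineDensity 2 (39/32) (-16) 1 1 pieces) [1] (2 ^ 60) (panelLeft 1 0) (panelLeft 1 16) (-71930218245259264) (-71930216900984832) := by
  have h := c121875_seg
  norm_num at h
  exact h

/-- THE `[-16, 16]` TRIAL FUNCTION IS A WITNESS AT `(2, 39/32)`: `UnstableWitness 2 (39/32) (-16) 16 X X′`, `2⁶⁰·W ≤ -71930216900984832` (`W ≈ -0.0624`;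
enclosure `[-0.0623895, -0.0623895]`). [cite: Freidberg2014, §12.3 eqs. (12.38)–(12.40)] -/
theorem unstableWitness_121875 :
    UnstableWitness 2 (39/32) (-16) 16 (trialX 1 1 pieces (-16)) (trialX' 1 1 pieces (-16)) := by
  have h := unstableWitness_of_spline (s := 2) (α := 39/32) (a := -16) (h := 1) (m := 1) (ps := pieces)
    one_pos one_pos pieces_ne_nil pieces_match pieces_deriv_match head_zero last_zero c121875_seg_all (by decide)
  rw [pieces_length] at h
  norm_num at h
  exact h

/-- THE GLUED SEGMENT at `α = 5/4` in summed form. [cite: MahboubiMelquiondSibutpinote2016, Sect. 3.3] -/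
theorem c125_seg_all :
    FSegOK (splineDensity 2 (5/4) (-16) 1 1 pieces) [1] (2 ^ 60) (panelLeft 1 0) (panelLeft 1 16) (-165867779080060928) (-165867777666580480) := by
  have h := c125_seg
  norm_num at h
  exact h

/-- THE `[-16, 16]` TRIAL FUNCTION IS A WITNESS AT `(2, 5/4)`: `UnstableWitness 2 (5/4) (-16) 16 X X′`, `2⁶⁰·W ≤ -165867777666580480` (`W ≈ -0.1439`;
enclosure `[-0.1438674, -0.1438674]`). [cite: Freidberg2014, §12.3 eqs. (12.38)–(12.40)] -/
theorem unstableWitness_125 :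
    UnstableWitness 2 (5/4) (-16) 16 (trialX 1 1 pieces (-16)) (trialX' 1 1 pieces (-16)) := by
  have h := unstableWitness_of_spline (s := 2) (α := 5/4) (a := -16) (h := 1) (m := 1) (ps := pieces)
    one_pos one_pos pieces_ne_nil pieces_match pieces_deriv_match head_zero last_zero c125_seg_all (by decide)
  rw [pieces_length] at h
  norm_num at h
  exact h

/-- ★★ THE BAND: the `[-16, 16]` trial function is a witness at EVERY `α ∈ [39/32, 5/4]` (the energy of a fixed trial function is a convex
quadratic polynomial in `α`): `U_{2} ⊇ [39/32, 5/4]`. [cite: Freidberg2014, §12.3 eqs. (12.38)–(12.40)] («… The plasma is unstable», for the band of the MODEL) -/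
theorem unstableWitness_band :
    ∀ α ∈ Icc (39/32 : ℝ) (5/4), UnstableWitness 2 α (-16) 16 (trialX 1 1 pieces (-16)) (trialX' 1 1 pieces (-16)) :=
  unstableWitness_of_mem_Icc unstableWitness_121875 unstableWitness_125

/-- … hence every point of the band carries SOME witness, [cite: Freidberg2014, §12.3 eqs. (12.38)–(12.40)] -/
theorem exists_unstableWitness_of_mem_band {α : ℝ} (hα : α ∈ Icc (39/32 : ℝ) (5/4)) :
    ∃ a b : ℝ, ∃ X X' : ℝ → ℝ, UnstableWitness 2 α a b X X' :=
  ⟨_, _, _, _, unstableWitness_band α hα⟩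

/-- … and none is on the stable side. [cite: Freidberg2014, §12.3 eq. (12.40)] -/
theorem not_stableSide_of_mem_band {α : ℝ} (hα : α ∈ Icc (39/32 : ℝ) (5/4)) : ¬ StableSide 2 α := by
  obtain ⟨a, b, X, X', hw⟩ := exists_unstableWitness_of_mem_band hα
  exact fun hs => hs a b X X' hw

/-- ★★★ THE SECOND-ROUND HALF-GAP END MOVE AT `s = 2` IN ONE STATEMENT: the lower end `37/32` is on the STABLE side (gridfusion-lit-4's
`SAlphaStableS2A115625.stableSide`, BY NAME) and the upper end `39/32` is NOT (this file's witness) — the first-stability edge of the MODEL at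
`s = 2` lies in the closed interval `[37/32, 39/32]` of width `1/16`. [cite: Freidberg2014, §12.3 eqs. (12.38)–(12.40)] -/
theorem endMove_two :
    StableSide (2) (37/32) ∧ ¬ StableSide (2) (39/32) :=
  ⟨Summit.Ventures.FusionMHD.Models.SAlphaStableS2A115625.stableSide,
   not_stableSide_of_mem_band ⟨le_rfl, by norm_num⟩⟩

end Summit.Ventures.FusionMHD.Bench.SAlphaS2W121875
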